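import Summits.KontsevichZagierPeriods.KontsevichZagierPeriods.Theorems.LinRedNormalFormArrangementNormalFormSeparateHighCuts
import Summits.KontsevichZagierPeriods.KontsevichZagierPeriods.Theorems.LinRedNormalFormArrangementNormalFormSeparateTwoZeroDissect

/-!
# The planar good-direction dissection, with fibres

(Line `janus-bands`, crux `ArrangementNormalForm`, stub `stub_separateTwoPos` — separation in a
good rational direction for planar Janus band representations WITH `k` fibres; part `Dissect`.)

`SepTwoPos.dissect` (registered as `separateTwoPos_dissect`): every planar Janus band
representation with `k` fibres (literal `JJ 2 k` data, non-zero active letters) is congruent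
modulo `KZ.relations` to a `ℤ`-combination of representations on GOOD pieces of the base in
good coordinates (the hypotheses of the piece theorem `SepTwoPos.piece_theorem`: every special
point has a double cone of two rows, special points are separated by rows, crossings of letters
are special, letters do not vanish on the open piece, `y`-free letters are non-zero constants).
The construction is the fibre-free one of `SepTwoZero.dissect`, the fibres riding along: cut the
BASE along all letters, the pencils of `#𝒳 + m + 2` rational slopes through every crossing
point and the separators (`SepHigh.cuts`, rule 1a with fibres); per piece choose the candidate
direction by pigeonhole off the sign patterns (`SepTwoZero.exists_good_candidate`) and make it
the `y`-axis (`separatePos_baseChange`, rule 2, fibre data transformed along).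
-/

noncomputable section

open Set MeasureTheory Filter Topology

namespace Summit.KontsevichZagierPeriods.ArrangementNormalForm.JanusBands

open Literature.NumberTheory.Transcendental

namespace SepTwoPos

open SeparatePos SepTwoZero

variable {k : ℕ}

/-- The literal value of a scaled form (base coordinates of `ℝ^{1+1+k}`). [folklore] -/
theorem litform_smul (ε : ℚ) (c : (Fin (1 + 1) → ℚ) × ℚ) (z : Fin (1 + 1 + k) → ℝ) :
    ∑ i, ((ε • c).1 i : ℝ) * z (Fin.castAdd k i) + ((ε • c).2 : ℝ) =
      (ε : ℝ) * (∑ i, (c.1 i : ℝ) * z (Fin.castAdd k i) + (c.2 : ℝ)) := by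
  simp only [Prod.smul_fst, Prod.smul_snd, Pi.smul_apply, smul_eq_mul, Rat.cast_mul,
    Finset.mul_sum, mul_add]
  refine congrArg (· + _) (Finset.sum_congr rfl fun i _ => by ring)

/-- **The planar good-direction dissection, with fibres.** Given an abstract terminal class
`Tset` containing every planar Janus band representation with `k` fibres on a GOOD piece of the
base (final coordinates, hypotheses of the piece theorem), every planar Janus band
representation with `k` fibres (literal `JJ 2 k` data with non-zero active letters) is
congruent modulo `KZ.relations` to a `ℤ`-combination of elements of `Tset`: cut the base along
all letters, along the pencils of `#𝒳 + m + 2` rational slopes through every crossing point and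
along the separators of pairs of crossing points (`SepHigh.cuts`, rule 1a); on each piece choose
by pigeonhole a candidate direction off the sign patterns of all crossing points and off the
letter directions (`exists_good_candidate`); make it the `y`-axis (`separatePos_baseChange`,
rule 2). [Kontsevich–Zagier 2001, §1.2, rules (1a), (2)] -/
theorem dissect (Tset : Set KZ.FormalRep)
    (hGood : ∀ (m m' : ℕ) (s : KZ.IntegralRep (1 + 1 + k)) (M : Fin m' → (Fin (1 + 1) → ℚ) × ℚ)
      (L : Fin m → (Fin (1 + 1) → ℚ) × ℚ) (e : Fin m → ℕ) (p : MvPolynomial (Fin (1 + 1)) ℚ)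
      (a : Fin k → Option ((Fin (1 + 1) → ℚ) × ℚ)) (lo hi : Fin k → Fin k ⊕ ((Fin (1 + 1) → ℚ) × ℚ))
      (𝒳 : Finset (ℚ × ℚ)), Bornology.IsBounded s.domain →
      s.domain = {z | (∀ j, 0 < ∑ i, ((M j).1 i : ℝ) * z (Fin.castAdd k i) + ((M j).2 : ℝ)) ∧
        ∀ i, Sum.elim (fun j => z (Fin.natAdd (1 + 1) j)) (fun c => ∑ i', (c.1 i' : ℝ) *
          z (Fin.castAdd k i') + (c.2 : ℝ)) (lo i) < z (Fin.natAdd (1 + 1) i) ∧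
          z (Fin.natAdd (1 + 1) i) < Sum.elim (fun j => z (Fin.natAdd (1 + 1) j))
          (fun c => ∑ i', (c.1 i' : ℝ) * z (Fin.castAdd k i') + (c.2 : ℝ)) (hi i)} →
      EqOn s.integrand (fun z => MvPolynomial.aeval (fun i => z (Fin.castAdd k i)) p /
        (∏ j, (∑ i, ((L j).1 i : ℝ) * z (Fin.castAdd k i) + ((L j).2 : ℝ)) ^ e j) *
        ∏ i, (a i).elim 1 (fun c => 1 / (z (Fin.natAdd (1 + 1) i) -
          (∑ i', (c.1 i' : ℝ) * z (Fin.castAdd k i') + (c.2 : ℝ))))) s.domain →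
      (∀ i i' (X : ℚ × ℚ), e i ≠ 0 → e i' ≠ 0 → (L i).1 1 ≠ 0 → (L i').1 1 ≠ 0 →
        evq (L i) X = 0 → evq (L i') X = 0 → (L i).1 0 * (L i').1 1 ≠ (L i).1 1 * (L i').1 0 →
        X ∈ 𝒳) →
      (∀ X ∈ 𝒳, ∃ j j', evq (M j) X = 0 ∧ evq (M j') X = 0 ∧ (M j).1 1 < 0 ∧ 0 < (M j').1 1) →
      (∀ X ∈ 𝒳, ∀ X' ∈ 𝒳, X ≠ X' → ∃ j, evq (M j) X * evq (M j) X' < 0) →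
      (∀ i, e i ≠ 0 → ∀ z ∈ s.domain,
        (∑ i', ((L i).1 i' : ℝ) * z (Fin.castAdd k i') + ((L i).2 : ℝ)) ≠ 0) →
      (∀ i, e i ≠ 0 → (L i).1 1 = 0 → ∃ c₀ > 0, ∀ z ∈ s.domain,
        c₀ ≤ |(∑ i', ((L i).1 i' : ℝ) * z (Fin.castAdd k i') + ((L i).2 : ℝ))|) →
      KZ.of s ∈ Tset)
    (m m' : ℕ) (s : KZ.IntegralRep (1 + 1 + k)) (M : Fin m' → (Fin (1 + 1) → ℚ) × ℚ)
    (L : Fin m → (Fin (1 + 1) → ℚ) × ℚ) (e : Fin m → ℕ) (p : MvPolynomial (Fin (1 + 1)) ℚ)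
    (a : Fin k → Option ((Fin (1 + 1) → ℚ) × ℚ)) (lo hi : Fin k → Fin k ⊕ ((Fin (1 + 1) → ℚ) × ℚ))
    (hbd : Bornology.IsBounded s.domain)
    (hdom : s.domain = {z | (∀ j, 0 < ∑ i, ((M j).1 i : ℝ) * z (Fin.castAdd k i) + ((M j).2 : ℝ)) ∧
        ∀ i, Sum.elim (fun j => z (Fin.natAdd (1 + 1) j)) (fun c => ∑ i', (c.1 i' : ℝ) *
          z (Fin.castAdd k i') + (c.2 : ℝ)) (lo i) < z (Fin.natAdd (1 + 1) i) ∧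
          z (Fin.natAdd (1 + 1) i) < Sum.elim (fun j => z (Fin.natAdd (1 + 1) j))
          (fun c => ∑ i', (c.1 i' : ℝ) * z (Fin.castAdd k i') + (c.2 : ℝ)) (hi i)})
    (hint : EqOn s.integrand (fun z => MvPolynomial.aeval (fun i => z (Fin.castAdd k i)) p /
        (∏ j, (∑ i, ((L j).1 i : ℝ) * z (Fin.castAdd k i) + ((L j).2 : ℝ)) ^ e j) *
        ∏ i, (a i).elim 1 (fun c => 1 / (z (Fin.natAdd (1 + 1) i) -
          (∑ i', (c.1 i' : ℝ) * z (Fin.castAdd k i') + (c.2 : ℝ))))) s.domain)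
    (hL : ∀ i, e i ≠ 0 → L i ≠ 0) :
    ∃ c ∈ AddSubgroup.closure Tset, KZ.of s - c ∈ KZ.relations := by
  classical
  -- the special points, the cut family
  set 𝒳₀ : Finset (ℚ × ℚ) := ((Finset.univ : Finset (Fin m × Fin m)).filter fun ii =>
    (L ii.1).1 0 * (L ii.2).1 1 - (L ii.1).1 1 * (L ii.2).1 0 ≠ 0).image
    fun ii => crossq (L ii.1) (L ii.2) with h𝒳₀
  set K := 𝒳₀.card + m with hK
  set cutf : Fin m ⊕ (𝒳₀ × Fin (K + 2)) ⊕ (𝒳₀ × 𝒳₀) → (Fin (1 + 1) → ℚ) × ℚ :=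
    Sum.elim (fun i => if L i = 0 then (![0, 0], 1) else L i)
      (Sum.elim (fun Xd => pencil Xd.1.1 Xd.2) fun XX => sepf XX.1.1 XX.2.1) with hcutf
  have hcut0 : ∀ i, cutf i ≠ 0 := by
    intro i
    rcases i with i | Xd | XX
    · simp only [hcutf, Sum.elim_inl]
      split_ifs with h
      · intro h0; have := congr_arg Prod.snd h0; simp at this
      · exact h
    · exact pencil_ne_zero _ _
    · exact sepf_ne_zero _ _
  set S : Finset ((Fin (1 + 1) → ℚ) × ℚ) := Finset.univ.image cutf with hS
  have hS0 : (0 : (Fin (1 + 1) → ℚ) × ℚ) ∉ S := fun h0 => by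
    obtain ⟨i, -, hi⟩ := Finset.mem_image.1 h0
    exact hcut0 i hi
  obtain ⟨c, hc, hrel⟩ := SepHigh.cuts (B := 1 + 1) (k := k) L e p a lo hi S hS0 m' M s hbd hdom hint
  -- every piece is congruent to an element of `Tset`
  suffices hmain : ∀ w ∈ SepHigh.Pieces (1 + 1) k m L e p a lo hi S m' M,
      ∃ c₁ ∈ AddSubgroup.closure Tset, w - c₁ ∈ KZ.relations by
    obtain ⟨c', hc', hcc⟩ := closure_transfer' hmain c hc
    refine ⟨c', hc', ?_⟩
    have := add_mem hrel hcc
    rwa [sub_add_sub_cancel] at this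
  rintro w ⟨m₁, M₁, s₁, -, hnew, hbd₁, hdom₁, hint₁, rfl⟩
  -- signs of the cut rows of this piece
  have hsig : ∀ i, ∃ j₁, ∃ ε : ℚ, (ε = 1 ∨ ε = -1) ∧ M₁ j₁ = ε • cutf i := fun i =>
    hnew (cutf i) (Finset.mem_image.2 ⟨i, Finset.mem_univ _, rfl⟩)
  choose jrow εrow hε hrow using hsig
  set ε : ℚ × ℚ → ℕ → ℚ := fun X d => if h : X ∈ 𝒳₀ ∧ d < K + 2 then
    εrow (Sum.inr (Sum.inl (⟨X, h.1⟩, ⟨d, h.2⟩))) else 1 with hεdef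
  obtain ⟨r, -, hgoodX, hgoodL⟩ := exists_good_candidate 𝒳₀ ε fun i => (L i).1
  set σ : ℚ := (r : ℚ) + 1 / 2 with hσ
  -- the base change
  obtain ⟨M', L', p', a', lo', hi', s', hM', hL', -, -, -, -, hmem, hbd', hdom', hint', hrel'⟩ :=
    separatePos_baseChange (1 + 1) k m m₁ s₁ M₁ L e p a lo hi hbd₁ hdom₁ hint₁ (Amat σ) (Ainv σ)
      (Amat_mul_Ainv σ) (Ainv_mul_Amat σ)
  have hM'' : ∀ j, M' j = bc σ (M₁ j) := hM'
  have hL'' : ∀ i, L' i = bc σ (L i) := hL'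
  refine ⟨KZ.of s', AddSubgroup.subset_closure (hGood m m₁ s' M' L' e p' a' lo' hi'
    (𝒳₀.image (Apt σ)) hbd' hdom' hint' ?_ ?_ ?_ ?_ ?_), hrel'⟩
  · -- crossings of letters are special points
    intro i i' Y _ _ _ _ h1 h2 hdet
    rw [hL''] at h1 h2 hdet
    rw [hL'' i'] at hdet
    have hY : Y = Apt σ (Ainvpt σ Y) := (Apt_Ainvpt σ Y).symm
    rw [hY, evq_bc] at h1 h2
    have hdet' := sub_ne_zero.2 hdet
    rw [det_bc] at hdet'
    refine Finset.mem_image.2 ⟨Ainvpt σ Y, ?_, hY.symm⟩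
    rw [h𝒳₀, eq_crossq hdet' h1 h2]
    exact Finset.mem_image.2 ⟨(i, i'), Finset.mem_filter.2 ⟨Finset.mem_univ _, hdet'⟩, rfl⟩
  · -- the double cone at every special point
    intro X' hX'
    obtain ⟨X, hX, rfl⟩ := Finset.mem_image.1 hX'
    have hg := hgoodX X hX
    push Not at hg
    obtain ⟨⟨d, hd, hεd⟩, ⟨d', hd', hεd'⟩⟩ := hg
    have hrowX : ∀ dd (hdd : dd < K + 2), ∃ j₁, M' j₁ = ε X dd • bc σ (pencil X dd) ∧
        (ε X dd = 1 ∨ ε X dd = -1) := fun dd hdd => by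
      set idx : Fin m ⊕ (𝒳₀ × Fin (K + 2)) ⊕ (𝒳₀ × 𝒳₀) :=
        Sum.inr (Sum.inl (⟨X, hX⟩, ⟨dd, hdd⟩)) with hidx
      have hεX : ε X dd = εrow idx := by
        rw [hεdef]; simp only [dif_pos (And.intro hX hdd), hidx]
      refine ⟨jrow idx, ?_, hεX ▸ hε idx⟩
      rw [hM'', hrow idx, bc_smul, hεX]
      simp [hcutf, hidx]
    obtain ⟨j₁, hj₁, hs₁⟩ := hrowX d hd
    obtain ⟨j₂, hj₂, hs₂⟩ := hrowX d' hd'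
    have e1 : ε X d = -sgn r d := eq_neg_of_ne_sgn hs₁ (sgn_sq r d) hεd
    have e2 : ε X d' = sgn r d' := by
      have := eq_neg_of_ne_sgn hs₂ (by rcases sgn_sq r d' with h | h <;> simp [h]) hεd'
      rw [this, neg_neg]
    refine ⟨j₁, j₂, ?_, ?_, ?_, ?_⟩
    · rw [hj₁, evq_smul, evq_bc, evq_pencil, mul_zero]
    · rw [hj₂, evq_smul, evq_bc, evq_pencil, mul_zero]
    · rw [hj₁, Prod.smul_fst, Pi.smul_apply, smul_eq_mul, bc_pencil_fst_one, e1, hσ, neg_mul]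
      exact neg_neg_of_pos (sgn_mul_pos r d)
    · rw [hj₂, Prod.smul_fst, Pi.smul_apply, smul_eq_mul, bc_pencil_fst_one, e2, hσ]
      exact sgn_mul_pos r d'
  · -- separation of the special points
    intro X' hX' X'' hX'' hne
    obtain ⟨X, hX, rfl⟩ := Finset.mem_image.1 hX'
    obtain ⟨X₂, hX₂, rfl⟩ := Finset.mem_image.1 hX''
    have hne₀ : X ≠ X₂ := fun h => hne (by rw [h])
    set idx : Fin m ⊕ (𝒳₀ × Fin (K + 2)) ⊕ (𝒳₀ × 𝒳₀) := Sum.inr (Sum.inr (⟨X, hX⟩, ⟨X₂, hX₂⟩))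
      with hidx
    refine ⟨jrow idx, ?_⟩
    rw [hM'', hrow idx, bc_smul, evq_smul, evq_smul, evq_bc, evq_bc]
    have hsep : cutf idx = sepf X X₂ := by simp [hcutf, hidx]
    rw [hsep]
    have hε2 : εrow idx * εrow idx = 1 := by rcases hε idx with h | h <;> rw [h] <;> norm_num
    have := evq_sepf_mul_neg hne₀
    nlinarith
  · -- letters do not vanish on the open piece
    intro i hei w hw
    have hz := (hmem w).1 hw
    rw [hdom₁] at hz
    have hj := hz.1 (jrow (Sum.inl i))
    rw [hrow (Sum.inl i), litform_smul] at hj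
    have hLi : cutf (Sum.inl i) = L i := by simp [hcutf, hL i hei]
    rw [hLi, form_sub] at hj
    rw [hL' i]
    intro h0
    rw [h0, mul_zero] at hj
    exact lt_irrefl _ hj
  · -- `y`-free letters are (non-zero) constants
    intro i hei hy1
    rw [hL'', bc_fst_one] at hy1
    have hlin : (L i).1 = 0 := by
      by_contra h; exact hgoodL i h hy1
    have hc2 : (L i).2 ≠ 0 := fun h => hL i hei (Prod.ext hlin h)
    refine ⟨|((L i).2 : ℝ)|, abs_pos.2 (by exact_mod_cast hc2), fun w _ => le_of_eq ?_⟩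
    rw [hL' i]
    congr 1
    simp [hlin, Matrix.vecMul, dotProduct]

end SepTwoPos

open SepTwoPos SepTwoZero SeparatePos in
/-- **The planar good-direction dissection, with fibres** (registered part of `stub_separateTwoPos`; see `SepTwoPos.dissect`). [Kontsevich–Zagier 2001, §1.2, rules (1a), (2)] -/
theorem separateTwoPos_dissect (k : ℕ) (Tset : Set KZ.FormalRep) (hGood : ∀ (m m' : ℕ) (s : KZ.IntegralRep (1 + 1 + k)) (M : Fin m' → (Fin (1 + 1) → ℚ) × ℚ) (L : Fin m → (Fin (1 + 1) → ℚ) × ℚ) (e : Fin m → ℕ) (p : MvPolynomial (Fin (1 + 1)) ℚ) (a : Fin k → Option ((Fin (1 + 1) → ℚ) × ℚ)) (lo hi : Fin k → Fin k ⊕ ((Fin (1 + 1) → ℚ) × ℚ)) (𝒳 : Finset (ℚ × ℚ)), Bornology.IsBounded s.domain → s.domain = {z | (∀ j, 0 < ∑ i, ((M j).1 i : ℝ) * z (Fin.castAdd k i) + ((M j).2 : ℝ)) ∧ ∀ i, Sum.elim (fun j => z (Fin.natAdd (1 + 1) j)) (fun c => ∑ i', (c.1 i' : ℝ) * z (Fin.castAdd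 k i') + (c.2 : ℝ)) (lo i) < z (Fin.natAdd (1 + 1) i) ∧ z (Fin.natAdd (1 + 1) i) < Sum.elim (fun j => z (Fin.natAdd (1 + 1) j)) (fun c => ∑ i', (c.1 i' : ℝ) * z (Fin.castAdd k i') + (c.2 : ℝ)) (hi i)} → EqOn s.integrand (fun z => MvPolynomial.aeval (fun i => z (Fin.castAdd k i)) p / (∏ j, (∑ i, ((L j).1 i : ℝ) * z (Fin.castAdd k i) + ((L j).2 : ℝ)) ^ e j) * ∏ i, (a i).elim 1 (fun c => 1 / (z (Fin.natAdd (1 + 1) i) - (∑ i', (c.1 i' : ℝ) * z (Fin.castAdd k i') + (c.2 : ℝ))))) s.domain → (∀ i i' (X : ℚ × ℚ), e i ≠ 0 → e i' ≠ 0 → (L i).1 1 ≠ 0 → (L i').1 1 ≠ 0 → evq (L i) X = 0 → evq (L i') X = 0 → (L i).1 0 * (L i').1 1 ≠ (L i).1 1 * (L i').1 0 → X ∈ 𝒳) → (∀ X ∈ 𝒳, ∃ j j', evq (M j) X = 0 ∧ evq (M j') X = 0 ∧ (M j).1 1 < 0 ∧ 0 < (M j').1 1) → (∀ X ∈ 𝒳,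 ∀ X' ∈ 𝒳, X ≠ X' → ∃ j, evq (M j) X * evq (M j) X' < 0) → (∀ i, e i ≠ 0 → ∀ z ∈ s.domain, (∑ i', ((L i).1 i' : ℝ) * z (Fin.castAdd k i') + ((L i).2 : ℝ)) ≠ 0) → (∀ i, e i ≠ 0 → (L i).1 1 = 0 → ∃ c₀ > 0, ∀ z ∈ s.domain, c₀ ≤ |(∑ i', ((L i).1 i' : ℝ) * z (Fin.castAdd k i') + ((L i).2 : ℝ))|) → KZ.of s ∈ Tset) (m m' : ℕ) (s : KZ.IntegralRep (1 + 1 + k)) (M : Fin m' → (Fin (1 + 1) → ℚ) × ℚ) (L : Fin m → (Fin (1 + 1) → ℚ) × ℚ) (e : Fin m → ℕ) (p : MvPolynomial (Fin (1 + 1)) ℚ) (a : Fin k → Option ((Fin (1 + 1) → ℚ) × ℚ)) (lo hi : Fin k → Fin k ⊕ ((Fin (1 + 1) → ℚ) × ℚ)) (hbd : Bornology.IsBounded s.domain) (hdom : s.domain = {z | (∀ j, 0 < ∑ i, ((M j).1 i : ℝ) * z (Fin.castAdd k i) + ((M j).2 : ℝ)) ∧ ∀ i, Sum.elim (fun j =>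 z (Fin.natAdd (1 + 1) j)) (fun c => ∑ i', (c.1 i' : ℝ) * z (Fin.castAdd k i') + (c.2 : ℝ)) (lo i) < z (Fin.natAdd (1 + 1) i) ∧ z (Fin.natAdd (1 + 1) i) < Sum.elim (fun j => z (Fin.natAdd (1 + 1) j)) (fun c => ∑ i', (c.1 i' : ℝ) * z (Fin.castAdd k i') + (c.2 : ℝ)) (hi i)}) (hint : EqOn s.integrand (fun z => MvPolynomial.aeval (fun i => z (Fin.castAdd k i)) p / (∏ j, (∑ i, ((L j).1 i : ℝ) * z (Fin.castAdd k i) + ((L j).2 : ℝ)) ^ e j) * ∏ i, (a i).elim 1 (fun c => 1 / (z (Fin.natAdd (1 + 1) i) - (∑ i', (c.1 i' : ℝ) * z (Fin.castAdd k i') + (c.2 : ℝ))))) s.domain) (hL : ∀ i, e i ≠ 0 → L i ≠ 0) : ∃ c ∈ AddSubgroup.closure Tset, KZ.of s - c ∈ KZ.relations := by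
  exact SepTwoPos.dissect Tset hGood m m' s M L e p a lo hi hbd hdom hint hL


end Summit.KontsevichZagierPeriods.ArrangementNormalForm.JanusBands
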